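import Summits.QuantumFields.BalabanUV.Beta.RelInvBlindTransport
import Summits.QuantumFields.BalabanUV.Beta.CombChartResolventRules
import Summits.QuantumFields.BalabanUV.Beta.SymRootedDressingKernel
import Summits.QuantumFields.BalabanUV.Beta.CombRootedAbsorbsSym
import Summits.QuantumFields.BalabanUV.Beta.CombChartSpreadSymBlind
import Summits.QuantumFields.BalabanUV.Beta.DshAn1Spread

/-!
# `BalabanUV.Beta.RelInvCombShiftedSpread` — binder row D1, RULING R-D1-g35-1: **P2 — THE RELATIVE INVERSE OF THE (0.4)-SYMMETRISED LEGGED SPREAD IN THE ROOTED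
# COMB SLICE**, `RelInv (coDressKAt ρ_c Lc (Gsym Lc j)) (bhKStepSh d Lc (Dsh Lc) j) (axEc ρ_c Lc)` for every `j` — ONE application of `RelInvBlindTransport.relInv_transport_of_blind_split` fed BY NAME by K0 `RelInvNullShift.relInv_Gsym_bhKStep_add` (chart (II)),
# K1 = leaf-03 g19's `CombChartSpreadBlind` (the legged spread is blind to the rooted comb dressing), K2 = leaf-03 g19's `CombChartSpreadSymBlind` (… and to the rooted
# symmetrised dressing), K3 `SymRootedDressingKernel` §3 (range), K4 = leaf-03 g19's `CombRootedAbsorbsSym` (absorption), K5 + rules 1–2 `CombChartResolventRules`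

HONEST FRAMING (cell contract, verbatim): «discharging `BetaPertH` makes Bałaban's UV stability UNCONDITIONAL — a real constructive-QFT
result; it is NOT the continuum limit and NOT the Clay problem.»  HONEST DEPENDENCY: continuum YM on T⁴ ⇐ BetaPertH ∧ nine spine estimates (0/9 proved);
BetaPertH ⇐ (D1) ∧ (D4) ∧ CAP+tail; G-an2-4 gates asym, D1 and NE2/3/4.
DERIVED cell leaf (β sub-cell, BINDER-OWNERS row D1 OWNER `b2b-balaban-beta-an2` gen 35).  No statement of Bałaban's papers, no `[cite:]`, no `Prop` fact, no `def`.
Discharges NO binder of the row (P2 is the relative-inverse SOCKET of the chart-(III′) repair track; the (III′) literal and its END come after); RECORD = ROOT M′ p303989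
(chart (II)) unchanged; NOT D1, NOT `BetaPertH`, NOT continuum, NOT Clay.
-/

noncomputable section

open Literature.Probability.LatticeModels (Torus.proj)
open Literature.MathematicalPhysics.QuantumFieldTheory
open Literature.MathematicalPhysics.QuantumFieldTheory.Balaban1983to89
open Literature.MathematicalPhysics.QuantumFieldTheory.Balaban1983to89.Beta
open ExpKernelCalculus (MKer comp)
open AffineAveraging (box toSite)
open AveragingContoursRooted (ctr ctrOff ctrOff_mem_box)
open KKTFluctuationKernel (delta1)
open OneStepResolventKernel (Fib)
open OneStepKernelFamily (KInvStep)
open Summit.QuantumFields.BalabanUV.Beta.TameKernelCalculus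
open Summit.QuantumFields.BalabanUV.Beta.ChartConjugationRelative (RelInv)
open Summit.QuantumFields.BalabanUV.Beta.AxialDressingRooted
open Summit.QuantumFields.BalabanUV.Beta.SymmetrisedStepJets (Gsym)
open Summit.QuantumFields.BalabanUV.Beta.RelInvFactorSandwich (spr_Gsym)
open Summit.QuantumFields.BalabanUV.Beta.SymShiftedSpread (bhKStepSh bhKStepSh_apply spr_bhKStepSh)
open Summit.QuantumFields.BalabanUV.Beta.DshAn1 (Dsh comp_comp_symEc_Dsh_symEc spr_Dsh)
open Summit.QuantumFields.BalabanUV.Beta.RelInvNullShift (relInv_Gsym_bhKStep_add)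
open Summit.QuantumFields.BalabanUV.Beta.SymSliceProjectorKernel (symEc trK_symEc)
open Summit.QuantumFields.BalabanUV.Beta.SymSliceProjectorSpread (spr_symEc)
open Summit.QuantumFields.BalabanUV.Beta.SymmetrisedDressingMatrix (bondIndR)
open Summit.QuantumFields.BalabanUV.Beta.SymRootedDressingKernel
open Summit.QuantumFields.BalabanUV.Beta.CombRootedAbsorbsSym (comp_trK_piK_trK_piKSym comp_piKSym_piK comp_comp_axEc_piKSym_symEc)
open Summit.QuantumFields.BalabanUV.Beta.CombChartSpreadSymBlind (comp_bhKStepSh_trK_piKSym comp_piKSym_bhKStepSh)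
open Summit.QuantumFields.BalabanUV.Beta.CombChartSpreadBlind (comp_bhKStepSh_trK_piK comp_piK_bhKStepSh)
open Summit.QuantumFields.BalabanUV.Beta.CombChartResolventRules (axEc_rules_coDressKAt_Gsym comp_trK_piK_axEc comp_axEc_piK)
open Summit.QuantumFields.BalabanUV.Beta.RelInvBlindTransport (relInv_transport_of_blind_split)
open Summit.QuantumFields.BalabanUV.Beta.BorderedHessian (bondInd_cast_eq_delta1)

namespace Summit.QuantumFields.BalabanUV.Beta.RelInvCombShiftedSpread

variable {d : ℕ} {Lc : ℕ} [NeZero Lc]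

/-- **P2 — THE RELATIVE INVERSE OF THE CHART-(III′) TRIPLE, EVERY LEVEL**: `RelInv (coDressKAt ρ_c Lc (Gsym Lc j)) (bhKStepSh d Lc (Dsh Lc) j) (axEc ρ_c Lc)`.
Everything BY NAME: K0 (`RelInvNullShift.relInv_Gsym_bhKStep_add` + (Dnull) `DshAn1.comp_comp_symEc_Dsh_symEc`), K1 (leaf-03 g19's `CombChartSpreadBlind.comp_piK_bhKStepSh` ∕
`comp_bhKStepSh_trK_piK`), K2 (leaf-03 g19's `CombChartSpreadSymBlind.comp_bhKStepSh_trK_piKSym` ∕ `comp_piKSym_bhKStepSh`), K3 weak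
(`SymRootedDressingKernel.comp_symEc_comp_trK_piKSym_axEc` + its transpose `CombRootedAbsorbsSym.comp_comp_axEc_piKSym_symEc`), K4 (leaf-03 g19's `CombRootedAbsorbsSym.comp_trK_piK_trK_piKSym` ∕ `comp_piKSym_piK`),
K5 (`CombChartResolventRules.comp_trK_piK_axEc` ∕ `comp_axEc_piK`), rules 1–2 (`axEc_rules_coDressKAt_Gsym`), assembled by `RelInvBlindTransport.relInv_transport_of_blind_split`.
[folklore]; RULING R-D1-g35-1's brick P2. -/
theorem relInv_coDressKAt_Gsym_bhKStepSh (j : ℕ) :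
    RelInv (coDressKAt (ctr (d + 1) Lc) Lc (Gsym (d := d) Lc j)) (bhKStepSh d Lc (Dsh Lc) j) (axEc (ctr (d + 1) Lc) Lc) := by
  have hL : 1 ≤ Lc := one_le_of_neZero Lc
  have hr : ctrOff (d + 1) Lc ∈ box (d + 1) Lc := ctrOff_mem_box hL
  have hK0 : RelInv (Gsym (d := d) Lc j) (bhKStepSh d Lc (Dsh Lc) j) (symEc Lc) := by
    rw [bhKStepSh_apply]
    exact relInv_Gsym_bhKStep_add j (spr_Dsh hL) (comp_comp_symEc_Dsh_symEc hL) _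
  obtain ⟨h1, h2⟩ := axEc_rules_coDressKAt_Gsym (d := d) (Lc := Lc) j
  rw [coDressKAt_eq] at h1 h2 ⊢
  exact relInv_transport_of_blind_split (spr_Gsym j) (spr_bhKStepSh (spr_Dsh hL) j) (spr_symEc hL) (spr_axEc _ _)
    (spr_trK_piK hL hr) (spr_piK hL hr) (spr_trK_piKSym hL hr) (spr_piKSym hL hr) hK0
    (comp_piK_bhKStepSh j) (comp_bhKStepSh_trK_piK j)
    (comp_bhKStepSh_trK_piKSym j) (comp_piKSym_bhKStepSh j) (comp_symEc_comp_trK_piKSym_axEc hL) comp_comp_axEc_piKSym_symEc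
    comp_trK_piK_trK_piKSym comp_piKSym_piK (comp_trK_piK_axEc hL hr) (comp_axEc_piK hL hr) h1 h2

/-- [folklore] **ALL LEVELS AT ONCE** — the chart-(III′) relative-inverse socket `∀ j` (the `hrel`-shaped binder of the comb-chart END files). -/
theorem relInv_coDressKAt_Gsym_bhKStepSh_all :
    ∀ j : ℕ, RelInv (coDressKAt (ctr (d + 1) Lc) Lc (Gsym (d := d) Lc j)) (bhKStepSh d Lc (Dsh Lc) j) (axEc (ctr (d + 1) Lc) Lc) :=
  fun j => relInv_coDressKAt_Gsym_bhKStepSh j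

end Summit.QuantumFields.BalabanUV.Beta.RelInvCombShiftedSpread

end
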